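import Literature.Topology.FourManifolds.CappellShanesonInvertibilityCriterion
import Literature.Topology.FourManifolds.CappellShanesonClassNumberTwoUnits
import Literature.NumberTheory.NumberFields.NumberRingDedekindCriteria
import HarnessLib

/-!
# Iwaki's Theorem 3.6 (Stevenhagen) for `ℤ[Θₙ]` and Theorem 3.11 in every vocabulary:
# `C(ℤ[Θₙ])` is a group ⟺ `ℤ[Θₙ]` is Dedekind ⟺ integrally closed ⟺ `= 𝒪_K` ⟺ no solution `(c, p)`

Source: K. Iwaki, *Infinite families of standard Cappell–Shaneson homotopy 4-spheres*, Topology Appl. 366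
(2025) 109293 = arXiv:2404.05096 [Iwaki2025] (held `paper:arxiv-2404.05096`, pp. 6–7), §3.1 Thm. 3.6 and §3.2
Thm. 3.11 (= Thm. A); M. H. Kim, S. Yamada, Kyungpook Math. J. 63 (2023) [KimYamada2023], Prop. 4.11.

VERBATIM [Iwaki2025, Thm. 3.6] ("[Stevenhagen:2008-1]"): "Let `𝒪_K` be the ring of integers of `K`. For an
order `R ⊂ K`, the following conditions are equivalent: • `R` is integrally closed, • `R` equals to `𝒪_K`,
• `R` is a Dedekind domain, • Every ideal of `R` is invertible, • `C(R)` is a group."  [Iwaki2025, Thm. 3.11]: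
"`C(ℤ[θₙ])` is not a group if and only if there exist an integer `c` and a prime number `p` which satisfy the
following equations: `(2c-1) n ≡ 3c² - 1 (mod p)`, `(c² - c) n ≡ c³ - c - 1 (mod p²)`."  [Iwaki2025, Example
3.2]: "`ℤ[θₙ]` is an order in the number field `ℚ(θₙ)`".

VOCABULARY (the tree's): `ℤ[Θₙ] = AdjoinRoot (csPoly n)` (`CappellShanesonIdealClasses`), a domain
(`isDomain_adjoinRoot_csPoly`) and a free `ℤ`-module of rank `3` — an ORDER in the sense of
`Literature/NumberTheory/NumberFields/NumberRingDedekindCriteria` (`Module.Finite ℤ`); `K` is its fraction field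
`FractionRing ℤ[Θₙ]`, `𝓞 K` Mathlib's ring of integers; "`C(ℤ[Θₙ])` is not a group" is, as in
`CappellShanesonInvertibilityCriterion` / `CappellShanesonNonInvertibleIdeals`, "some non-zero ideal `I` has
no `J` and `x, y ≠ 0` with `(x)(IJ) = (y)ℤ[Θₙ]`".  This file JOINS the abstract criteria (Stevenhagen 2008
§4–§6, `order_integrallyClosed_tfae`) with the tree's biconditional `iwaki2025_thm_3_11_iff`.

## What is formalised (theorems only; no definition, no instance, no named fact — net Literature debt 0)

* §1 `moduleFinite_adjoinRoot_csPoly` (`ℤ[Θₙ]` is an order) and **Thm. 3.6 for `ℤ[Θₙ]`**: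
  `iwaki2025_thm_3_6` — seven equivalent phrasings (integrally closed · `= 𝒪_K` as subrings of `K` · Dedekind ·
  every ideal a unit of `FractionalIdeal` · every fractional ideal a unit · Stevenhagen's "`IJ` non-zero
  principal" · Iwaki's class-monoid form "`(x)(IJ) = (y)R`").
* §2 **Thm. 3.11 in every vocabulary** (`iwaki2025_thm_3_11_iff` transported along §1):
  `not_isDedekindDomain_iff_exists_modEq`, `not_isIntegrallyClosed_iff_exists_modEq`,
  `isDedekindDomain_iff_forall_not_modEq`, `isIntegrallyClosed_iff_forall_not_modEq`,
  `range_eq_range_ringOfIntegers_iff_forall_not_modEq` (`ℤ[Θₙ] = 𝒪_K` ⟺ no solution),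
  `forall_isUnit_coeIdeal_iff_forall_not_modEq` (every ideal invertible ⟺ no solution).
* §3 **Instances**: `not_isDedekindDomain_of_modEq`; Kim–Yamada Prop. 4.11 as "`ℤ[Θ_{49k+27}]` is not
  Dedekind" (`not_isDedekindDomain_fortynine_mul_add_twentyseven`); Iwaki's Example 3.10 list as non-Dedekind
  orders (`iwaki2025_example_3_10_not_isDedekindDomain`); conversely, when `Δ(fₐ)` has no square factor
  (`𝒪_K = ℤ[θ]`, the Part-A hypothesis of the per-trace class-group files) `ℤ[Θₐ]` is integrally closed and
  Dedekind and the congruences have NO solution (`isIntegrallyClosed_adjoinRoot_csPoly_of_sq`,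
  `isDedekindDomain_adjoinRoot_csPoly_of_sq`, `forall_not_modEq_of_sq`), e.g. `n = 58`
  (`isDedekindDomain_adjoinRoot_csPoly_fiftyeight`, `forall_not_modEq_fiftyeight`).

## References
* [Iwaki2025] K. Iwaki, Topology Appl. 366 (2025) 109293: Ex. 3.2, Thm. 3.6, Ex. 3.10, Thm. 3.11.
* [Stevenhagen2008NumberRings] P. Stevenhagen, *The arithmetic of number rings*, MSRI Publ. 44 (2008): §4–§6.
* [KimYamada2023] M. H. Kim, S. Yamada, Kyungpook Math. J. 63 (2023): Prop. 4.11.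
* [Marcus2018] D. A. Marcus, *Number Fields*, 2nd ed.: Ch. 2 Exercise 27 (`𝒪_K = ℤ[θ]` from the discriminant).
-/

noncomputable section

open Polynomial Ideal
open scoped nonZeroDivisors NumberField

namespace Literature.Topology.FourManifolds

open Literature.NumberTheory.NumberFields

/-! ### §1 `ℤ[Θₙ]` is an order; Theorem 3.6 for it -/

section Order

variable (n : ℤ)

/-- **`ℤ[θₙ]` is an order** ("`ℤ[θₙ]` is an order in the number field `ℚ(θₙ)`"): `ℤ[Θₙ] = ℤ[X]/(fₙ)` is a
finitely generated (indeed free of rank `3`) `ℤ`-module, `fₙ` being monic. [cite: Iwaki2025, Example 3.2] -/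
theorem moduleFinite_adjoinRoot_csPoly : Module.Finite ℤ (AdjoinRoot (csPoly n)) :=
  (monic_csPoly n).finite_adjoinRoot

/-- **Iwaki 2025, Theorem 3.6 (Stevenhagen 2008) for the order `R = ℤ[Θₙ]`, `K = Frac R`: the following are
equivalent** — (1) `R` is integrally closed; (2) `R = 𝒪_K` (as subrings of `K`); (3) `R` is a Dedekind domain;
(4) every non-zero ideal of `R` is invertible (a unit of the monoid of fractional ideals); (5) every non-zero
fractional ideal is invertible; (6) for every non-zero ideal `I` some `IJ` is non-zero principal; (7) `C(R)` is a
group: every class `[I] ≠ 0` has `J`, `x, y ≠ 0` with `(x)(IJ) = (y)R`.  (The phrasing "`R` is the integral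
closure of `ℤ` in `K`" is item 3 of the abstract `order_integrallyClosed_tfae`.) [cite: Iwaki2025, Thm. 3.6] [cite: Stevenhagen2008NumberRings, §4, §5 Prop. 5.4, §6 Cor. 6.3 and Thm. 6.5] -/
theorem iwaki2025_thm_3_6 :
    List.TFAE
      [IsIntegrallyClosed (AdjoinRoot (csPoly n)),
        (algebraMap (AdjoinRoot (csPoly n)) (FractionRing (AdjoinRoot (csPoly n)))).range =
          (algebraMap (𝓞 (FractionRing (AdjoinRoot (csPoly n)))) (FractionRing (AdjoinRoot (csPoly n)))).range,
        IsDedekindDomain (AdjoinRoot (csPoly n)),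
        ∀ I : Ideal (AdjoinRoot (csPoly n)), I ≠ ⊥ →
          IsUnit (I : FractionalIdeal (AdjoinRoot (csPoly n))⁰ (FractionRing (AdjoinRoot (csPoly n)))),
        ∀ I : FractionalIdeal (AdjoinRoot (csPoly n))⁰ (FractionRing (AdjoinRoot (csPoly n))), I ≠ 0 → IsUnit I,
        ∀ I : Ideal (AdjoinRoot (csPoly n)), I ≠ ⊥ →
          ∃ (J : Ideal (AdjoinRoot (csPoly n))) (y : AdjoinRoot (csPoly n)), y ≠ 0 ∧ I * J = Ideal.span {y},
        ∀ I : Ideal (AdjoinRoot (csPoly n)), I ≠ ⊥ →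
          ∃ (J : Ideal (AdjoinRoot (csPoly n))) (x y : AdjoinRoot (csPoly n)), x ≠ 0 ∧ y ≠ 0 ∧
            Ideal.span {x} * (I * J) = Ideal.span {y} * ⊤] := by
  haveI := moduleFinite_adjoinRoot_csPoly n
  have h := order_integrallyClosed_tfae (AdjoinRoot (csPoly n)) (FractionRing (AdjoinRoot (csPoly n)))
  tfae_have 1 ↔ 2 := h.out 0 1
  tfae_have 1 ↔ 3 := h.out 0 3
  tfae_have 3 ↔ 4 := h.out 3 4
  tfae_have 3 ↔ 5 := h.out 3 5
  tfae_have 3 ↔ 6 := h.out 3 6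
  tfae_have 6 ↔ 7 := forall_congr' fun I => imp_congr_right fun _ => exists_mul_eq_span_iff I
  tfae_finish

end Order

/-! ### §2 Theorem 3.11 in every vocabulary -/

section Theorem311

variable (n : ℤ)

/-- **`ℤ[Θₙ]` is NOT a Dedekind domain ⟺ Iwaki's congruences have a solution** `(c, p)`, `p` prime:
Thm. 3.11 ("`C(ℤ[θₙ])` is not a group iff …") read through Thm. 3.6 ("`C(R)` is a group ⟺ `R` is a Dedekind
domain"). [cite: Iwaki2025, Thm. 3.11 and Thm. 3.6] -/
theorem not_isDedekindDomain_iff_exists_modEq :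
    ¬ IsDedekindDomain (AdjoinRoot (csPoly n)) ↔
      ∃ c p : ℤ, Prime p ∧ (2 * c - 1) * n ≡ 3 * c ^ 2 - 1 [ZMOD p] ∧
        (c ^ 2 - c) * n ≡ c ^ 3 - c - 1 [ZMOD p ^ 2] := by
  rw [← iwaki2025_thm_3_11_iff n, isDedekindDomain_iff_forall_exists_mul_eq_span (AdjoinRoot (csPoly n)),
    not_forall]
  refine exists_congr fun I => ?_
  rw [Classical.not_imp, exists_mul_eq_span_iff]

/-- **`ℤ[Θₙ]` is a Dedekind domain ⟺ no `(c, p)` solves the congruences.** [cite: Iwaki2025, Thm. 3.11 and Thm. 3.6] -/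
theorem isDedekindDomain_iff_forall_not_modEq :
    IsDedekindDomain (AdjoinRoot (csPoly n)) ↔
      ∀ c p : ℤ, Prime p → (2 * c - 1) * n ≡ 3 * c ^ 2 - 1 [ZMOD p] →
        ¬ (c ^ 2 - c) * n ≡ c ^ 3 - c - 1 [ZMOD p ^ 2] := by
  have h := not_isDedekindDomain_iff_exists_modEq n
  constructor
  · intro hD c p hp h₁ h₂
    exact h.mpr ⟨c, p, hp, h₁, h₂⟩ hD
  · intro hall
    by_contra hD
    obtain ⟨c, p, hp, h₁, h₂⟩ := h.mp hD
    exact hall c p hp h₁ h₂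

/-- **`ℤ[Θₙ]` is NOT integrally closed ⟺ the congruences have a solution** (Thm. 3.11 through Thm. 3.6
"`R` is integrally closed ⟺ `C(R)` is a group"; the ⇐ half is the tree's `not_isIntegrallyClosed_of_modEq`,
Kim–Yamada Prop. 4.11). [cite: Iwaki2025, Thm. 3.11 and Thm. 3.6] [cite: KimYamada2023, Prop. 4.11] -/
theorem not_isIntegrallyClosed_iff_exists_modEq :
    ¬ IsIntegrallyClosed (AdjoinRoot (csPoly n)) ↔
      ∃ c p : ℤ, Prime p ∧ (2 * c - 1) * n ≡ 3 * c ^ 2 - 1 [ZMOD p] ∧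
        (c ^ 2 - c) * n ≡ c ^ 3 - c - 1 [ZMOD p ^ 2] := by
  haveI := moduleFinite_adjoinRoot_csPoly n
  rw [← isDedekindDomain_iff_isIntegrallyClosed (AdjoinRoot (csPoly n))]
  exact not_isDedekindDomain_iff_exists_modEq n

/-- **`ℤ[Θₙ]` is integrally closed ⟺ no `(c, p)` solves the congruences.** [cite: Iwaki2025, Thm. 3.11 and Thm. 3.6] -/
theorem isIntegrallyClosed_iff_forall_not_modEq :
    IsIntegrallyClosed (AdjoinRoot (csPoly n)) ↔
      ∀ c p : ℤ, Prime p → (2 * c - 1) * n ≡ 3 * c ^ 2 - 1 [ZMOD p] →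
        ¬ (c ^ 2 - c) * n ≡ c ^ 3 - c - 1 [ZMOD p ^ 2] := by
  haveI := moduleFinite_adjoinRoot_csPoly n
  rw [← isDedekindDomain_iff_isIntegrallyClosed (AdjoinRoot (csPoly n))]
  exact isDedekindDomain_iff_forall_not_modEq n

/-- **`ℤ[Θₙ] = 𝒪_K` (the maximal order of `K = ℚ(Θₙ) = Frac ℤ[Θₙ]`, as subrings of `K`) ⟺ no `(c, p)` solves
the congruences** (Thm. 3.11 through Thm. 3.6 "`R` equals to `𝒪_K` ⟺ `C(R)` is a group").
[cite: Iwaki2025, Thm. 3.11 and Thm. 3.6] -/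
theorem range_eq_range_ringOfIntegers_iff_forall_not_modEq :
    (algebraMap (AdjoinRoot (csPoly n)) (FractionRing (AdjoinRoot (csPoly n)))).range =
        (algebraMap (𝓞 (FractionRing (AdjoinRoot (csPoly n)))) (FractionRing (AdjoinRoot (csPoly n)))).range ↔
      ∀ c p : ℤ, Prime p → (2 * c - 1) * n ≡ 3 * c ^ 2 - 1 [ZMOD p] →
        ¬ (c ^ 2 - c) * n ≡ c ^ 3 - c - 1 [ZMOD p ^ 2] := by
  haveI := moduleFinite_adjoinRoot_csPoly n
  rw [← isIntegrallyClosed_iff_range_eq_range_ringOfIntegers (AdjoinRoot (csPoly n))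
    (FractionRing (AdjoinRoot (csPoly n)))]
  exact isIntegrallyClosed_iff_forall_not_modEq n

/-- **Every ideal of `ℤ[Θₙ]` is invertible ⟺ no `(c, p)` solves the congruences** (Thm. 3.11 through
Thm. 3.6 "Every ideal of `R` is invertible ⟺ `C(R)` is a group"). [cite: Iwaki2025, Thm. 3.11 and Thm. 3.6] -/
theorem forall_isUnit_coeIdeal_iff_forall_not_modEq :
    (∀ I : Ideal (AdjoinRoot (csPoly n)), I ≠ ⊥ →
        IsUnit (I : FractionalIdeal (AdjoinRoot (csPoly n))⁰ (FractionRing (AdjoinRoot (csPoly n))))) ↔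
      ∀ c p : ℤ, Prime p → (2 * c - 1) * n ≡ 3 * c ^ 2 - 1 [ZMOD p] →
        ¬ (c ^ 2 - c) * n ≡ c ^ 3 - c - 1 [ZMOD p ^ 2] := by
  rw [← isDedekindDomain_iff_forall_isUnit_coeIdeal (AdjoinRoot (csPoly n))
    (FractionRing (AdjoinRoot (csPoly n)))]
  exact isDedekindDomain_iff_forall_not_modEq n

end Theorem311

/-! ### §3 Instances: non-Dedekind `ℤ[Θₙ]` from a solution; Dedekind `ℤ[Θₙ]` (no solution) from the discriminant -/

section Instances

variable {n c p : ℤ}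

/-- A solution `(c, p)` makes `ℤ[Θₙ]` a NON-Dedekind order ("Moreover, `⟨θₙ - c, p⟩` is a non-invertible
ideal"). [cite: Iwaki2025, Thm. 3.11 and Thm. 3.6] -/
theorem not_isDedekindDomain_of_modEq (hp : Prime p) (h₁ : (2 * c - 1) * n ≡ 3 * c ^ 2 - 1 [ZMOD p])
    (h₂ : (c ^ 2 - c) * n ≡ c ^ 3 - c - 1 [ZMOD p ^ 2]) : ¬ IsDedekindDomain (AdjoinRoot (csPoly n)) :=
  (not_isDedekindDomain_iff_exists_modEq n).mpr ⟨c, p, hp, h₁, h₂⟩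

/-- **Kim–Yamada Prop. 4.11 in Dedekind form: `ℤ[Θ_{49k+27}]` is not a Dedekind domain** (`c = 2`,
`p = 7`; the tree's `kimYamada2023_prop_4_11` gives "not integrally closed"). [cite: KimYamada2023, Prop. 4.11] [cite: Iwaki2025, Thm. 3.6 and Cor. 3.12] -/
theorem not_isDedekindDomain_fortynine_mul_add_twentyseven (k : ℤ) :
    ¬ IsDedekindDomain (AdjoinRoot (csPoly (49 * k + 27))) := by
  haveI := moduleFinite_adjoinRoot_csPoly (49 * k + 27)
  rw [isDedekindDomain_iff_isIntegrallyClosed (AdjoinRoot (csPoly (49 * k + 27)))]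
  exact kimYamada2023_prop_4_11 k

/-- **Iwaki's Example 3.10 as non-Dedekind orders**: for the 39 traces `n ∈ [0, 1000]` listed there
("`C(ℤ[θₙ])` is not a group"), `ℤ[Θₙ]` is not a Dedekind domain. [cite: Iwaki2025, Example 3.10 and Thm. 3.6] -/
theorem iwaki2025_example_3_10_not_isDedekindDomain : ∀ n ∈ (
    [27, 76, 94, 125, 127, 159, 167, 174, 223, 235, 272, 284, 299, 321, 370, 416, 419, 440, 456, 468, 517,
      566, 615, 623, 664, 705, 713, 745, 762, 764, 807, 811, 828, 860, 909, 958, 969, 975, 994] : List ℤ),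
    ¬ IsDedekindDomain (AdjoinRoot (csPoly n)) := by
  intro n hn hD
  haveI := hD
  exact iwaki2025_example_3_10 n hn inferInstance

variable {a : ℤ}

/-- **No square factor in `Δ(fₐ)` ⇒ `ℤ[Θₐ]` is integrally closed**: then `ℤ[Θₐ] ≅ 𝓞 K` for the cubic field
`K = ℚ[x]/(fₐ)` (`exists_ringEquiv_adjoinRoot_of_sq`, Marcus Ch. 2 Ex. 27), and `𝓞 K` is integrally closed.
[cite: Marcus2018, Ch. 2, Exercise 27] [cite: Iwaki2025, Thm. 3.6] -/
theorem isIntegrallyClosed_adjoinRoot_csPoly_of_sq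
    (hsq : ∀ r e : ℤ, csDisc a = r ^ 2 * e → 2 < |e| → IsUnit r) :
    IsIntegrallyClosed (AdjoinRoot (csPoly a)) := by
  obtain ⟨e, -⟩ := exists_ringEquiv_adjoinRoot_of_sq (K := CSField a) (aeval_root_csPoly a)
    (finrank_CSField a) hsq
  exact IsIntegrallyClosed.of_equiv e.symm

/-- **No square factor in `Δ(fₐ)` ⇒ `ℤ[Θₐ]` is a Dedekind domain** (an integrally closed order).
[cite: Iwaki2025, Thm. 3.6] [cite: Marcus2018, Ch. 2, Exercise 27] -/
theorem isDedekindDomain_adjoinRoot_csPoly_of_sq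
    (hsq : ∀ r e : ℤ, csDisc a = r ^ 2 * e → 2 < |e| → IsUnit r) :
    IsDedekindDomain (AdjoinRoot (csPoly a)) := by
  haveI := moduleFinite_adjoinRoot_csPoly a
  exact (isDedekindDomain_iff_isIntegrallyClosed (AdjoinRoot (csPoly a))).mpr
    (isIntegrallyClosed_adjoinRoot_csPoly_of_sq hsq)

/-- **No square factor in `Δ(fₐ)` ⇒ Iwaki's congruences have no solution for the trace `a`** (Thm. 3.11 ⇒,
contrapositive: a solution would make `C(ℤ[Θₐ])` a non-group). [cite: Iwaki2025, Thm. 3.11 and Thm. 3.6] -/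
theorem forall_not_modEq_of_sq (hsq : ∀ r e : ℤ, csDisc a = r ^ 2 * e → 2 < |e| → IsUnit r) :
    ∀ c p : ℤ, Prime p → (2 * c - 1) * a ≡ 3 * c ^ 2 - 1 [ZMOD p] →
      ¬ (c ^ 2 - c) * a ≡ c ^ 3 - c - 1 [ZMOD p ^ 2] :=
  (isDedekindDomain_iff_forall_not_modEq a).mp (isDedekindDomain_adjoinRoot_csPoly_of_sq hsq)

/-- **Example: `ℤ[Θ₅₈]` is a Dedekind domain** (`Δ(f₅₈) = 9467897 = 967 · 9791` squarefree, the Part-A input of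
the trace-`58` class-group computation `csDisc_fiftyeight_sq`). [cite: Iwaki2025, Thm. 3.6] [cite: KimYamada2023, §5 (trace 58)] -/
theorem isDedekindDomain_adjoinRoot_csPoly_fiftyeight : IsDedekindDomain (AdjoinRoot (csPoly 58)) :=
  isDedekindDomain_adjoinRoot_csPoly_of_sq csDisc_fiftyeight_sq

/-- Hence **no `(c, p)` solves Iwaki's congruences for `n = 58`** (`C(ℤ[Θ₅₈])` is a group — the class group of
order `36` computed in `CappellShanesonClassGroupFiftyeight*`). [cite: Iwaki2025, Thm. 3.11] -/
theorem forall_not_modEq_fiftyeight :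
    ∀ c p : ℤ, Prime p → (2 * c - 1) * 58 ≡ 3 * c ^ 2 - 1 [ZMOD p] →
      ¬ (c ^ 2 - c) * 58 ≡ c ^ 3 - c - 1 [ZMOD p ^ 2] :=
  forall_not_modEq_of_sq csDisc_fiftyeight_sq

end Instances

end Literature.Topology.FourManifolds

end
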